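import Mathlib
import HarnessLib
import Literature.AlgebraicGeometry.Ramification.InertiaNormalSylow
import Literature.AlgebraicGeometry.Resolution.StalkIdealLemmas
import Summits.ResolutionOfSingularities.ResolutionOfSingularities.Theorems.WildQuotientsWildQuotientResolutionStandardFormPhaseZero

/-!
# Stable boundary lines: the stalk ideal of an `I_x`-stable closed set is stable under the stalk action
# (crux `WildQuotients.WildQuotientResolution`, stub `stub_phaseZeroHighDim`; any dimension)

Crux stmt-ResolutionOfSingularities-15640 (`WildQuotientResolution`), registered stub `stub_phaseZeroHighDim`.
The standard-form criterion ✓`StandardForm.hasNormalSylow_inertia_of_standardForm` (p821758) has TWO hypotheses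
on the boundary at `x`: (hstab) each boundary equation `zᵢ` spans a line of `𝔪_x/𝔪_x²` stable under the stalk
action of `I_x`, and (hfix) the tame inert loci lie in the boundary (transported by ✓`StandardFormTransport`,
p821870). This file supplies (hstab) from GEOMETRY: if a closed set `D ⊆ X` is stable under a subgroup `I`
fixing `x` (`(σ g)⁻¹ D = D` for `g ∈ I` — e.g. `D` the exceptional divisor over ONE translate of an orbit centre
with pairwise disjoint translates, which no element fixing a point of `D` can move to another translate; or the
strict transform of such a divisor), then the stalk `I(D)_x` of its vanishing ideal sheaf is stable under the
stalk action `τ` of `I` (`apply_mem_stalkIdeal_vanishingIdeal`); so when `D` is a regular divisor at `x`, i.e.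
`I(D)_x = (t)`, the line `κ t̄` is stable: `τ g t ∈ (t) ⊆ (t) + 𝔪_x²` (`apply_mem_span_of_stalkIdeal_eq_span`).
In words: boundaries built from exceptional divisors of orbit tame moves with disjoint translates are
automatically `G`-STRICT, and (hstab) costs nothing.

Proof: `I(D)_x` is radical, hence the intersection of the primes `𝔮` of `𝒪_{X,x}` whose generization
`ι_x(𝔮)` lies in `D` (✓`fromSpecStalk_mem_iff_stalkIdeal_vanishingIdeal_le`); the stalk action permutes these
primes because `Spec(a_g) ≫ ι_x = ι_x ≫ σ g` and `σ g` preserves `D`.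

[OURS · crux stmt-ResolutionOfSingularities-15640 · helper toward `stub_phaseZeroHighDim` (the stable-line
hypothesis of the standard-form end state; NOT a proof of the stub); folklore, counted 0; AI-level work, weaker
than expert review.] [folklore]
-/

-- single-problem summit: the doubled namespace component `ResolutionOfSingularities` is forced
set_option linter.dupNamespace false

noncomputable section

open CategoryTheory AlgebraicGeometry TopologicalSpace IsLocalRing
open Literature.AlgebraicGeometry.Resolution Literature.AlgebraicGeometry.Ramification
open Scheme.IdealSheafData

namespace Summit.ResolutionOfSingularities.ResolutionOfSingularities.Theorems.WildQuotientResolution.StandardForm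

section StableSet

variable {X : Scheme.{0}} {G : Type} [Group G] (σ : G →* Aut X) (x : X) {I : Subgroup G}
  (a : I → (X.presheaf.stalk x ⟶ X.presheaf.stalk x))
  (τ : I →* (X.presheaf.stalk x ≃+* X.presheaf.stalk x))
  (hkey : ∀ g : I, Spec.map (a g) ≫ X.fromSpecStalk x = X.fromSpecStalk x ≫ (σ (g : G)).hom)
  (hτ : ∀ (g : I) (r : X.presheaf.stalk x), τ g r = (a g⁻¹).hom r)

/-- The stalk of a vanishing ideal sheaf is a radical ideal. [folklore] -/
theorem radical_stalkIdeal_vanishingIdeal (D : Closeds X) :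
    (stalkIdeal (vanishingIdeal D) x).radical = stalkIdeal (vanishingIdeal D) x := by
  have hsupp : (vanishingIdeal D).support = D :=
    TopologicalSpace.Closeds.ext (coe_support_vanishingIdeal (Z := D))
  have hrad : (vanishingIdeal D).radical = vanishingIdeal D := by
    rw [← vanishingIdeal_support, hsupp]
  rw [← stalkIdeal_radical, hrad]

/-- The stalk of the vanishing ideal sheaf of `D` at `x` is the intersection of the primes of `𝒪_{X,x}` whose
generization lies in `D`. [folklore] -/
theorem stalkIdeal_vanishingIdeal_eq_sInf (D : Closeds X) :
    stalkIdeal (vanishingIdeal D) x =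
      sInf {P : Ideal (X.presheaf.stalk x) | ∃ hP : P.IsPrime, (X.fromSpecStalk x).base ⟨P, hP⟩ ∈ (D : Set X)} := by
  rw [← radical_stalkIdeal_vanishingIdeal x D, Ideal.radical_eq_sInf]
  congr 1
  ext P
  constructor
  · rintro ⟨hle, hP⟩
    exact ⟨hP, (fromSpecStalk_mem_iff_stalkIdeal_vanishingIdeal_le x D ⟨P, hP⟩).mpr hle⟩
  · rintro ⟨hP, hmem⟩
    exact ⟨(fromSpecStalk_mem_iff_stalkIdeal_vanishingIdeal_le x D ⟨P, hP⟩).mp hmem, hP⟩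

include hkey hτ

/-- **The stalk ideal of an `I`-stable closed set is stable under the stalk action.** Let `(a, τ)` be a stalk
action at `x` of a subgroup `I` fixing `x` (`Spec(a_g) ≫ ι_x = ι_x ≫ σ g`, `τ g = a_{g⁻¹}`), and `D ⊆ X` closed
with `(σ g)⁻¹ D = D` for all `g ∈ I`. Then `τ g` maps `I(D)_x` into itself. [folklore] -/
theorem apply_mem_stalkIdeal_vanishingIdeal (D : Closeds X)
    (hD : ∀ g : I, (σ (g : G)).hom.base ⁻¹' (D : Set X) = D) (g : I) {r : X.presheaf.stalk x}
    (hr : r ∈ stalkIdeal (vanishingIdeal D) x) : τ g r ∈ stalkIdeal (vanishingIdeal D) x := by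
  rw [stalkIdeal_vanishingIdeal_eq_sInf x D, Ideal.mem_sInf]
  rintro P ⟨hP, hmem⟩
  -- the translate `𝔮' = Spec(a_{g⁻¹})(𝔮)` of `𝔮 = P` also maps into `D`
  set 𝔮 : Spec (X.presheaf.stalk x) := ⟨P, hP⟩ with h𝔮
  have hmem' : (X.fromSpecStalk x).base ((Spec.map (a g⁻¹)).base 𝔮) ∈ (D : Set X) := by
    have e := congrArg (fun f : Spec (X.presheaf.stalk x) ⟶ X => f.base 𝔮) (hkey g⁻¹)
    rw [Scheme.Hom.comp_apply, Scheme.Hom.comp_apply] at e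
    rw [e]
    have h : (X.fromSpecStalk x).base 𝔮 ∈ (σ ((g⁻¹ : I) : G)).hom.base ⁻¹' (D : Set X) := by
      rw [hD]; exact hmem
    exact h
  have hle : stalkIdeal (vanishingIdeal D) x ≤ ((Spec.map (a g⁻¹)).base 𝔮).asIdeal :=
    (fromSpecStalk_mem_iff_stalkIdeal_vanishingIdeal_le x D _).mp hmem'
  have h2 : r ∈ ((Spec.map (a g⁻¹)).base 𝔮).asIdeal := hle hr
  rw [hτ]
  exact h2

/-- **Stable line of a stable regular divisor**: if moreover `I(D)_x` is principal, generated by `t` (a regular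
divisor `D` through the regular point `x`), then `τ g t ∈ (t)`; in particular `τ g t ∈ (t) + 𝔪_x²`, the
hypothesis (hstab) of ✓`hasNormalSylow_inertia_of_standardForm`. [folklore] -/
theorem apply_mem_span_of_stalkIdeal_eq_span (D : Closeds X)
    (hD : ∀ g : I, (σ (g : G)).hom.base ⁻¹' (D : Set X) = D) {t : X.presheaf.stalk x}
    (ht : stalkIdeal (vanishingIdeal D) x = Ideal.span {t}) (g : I) :
    τ g t ∈ Ideal.span {t} ⊔ maximalIdeal (X.presheaf.stalk x) ^ 2 := by
  have h : τ g t ∈ stalkIdeal (vanishingIdeal D) x :=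
    apply_mem_stalkIdeal_vanishingIdeal σ x a τ hkey hτ D hD g (ht ▸ Ideal.mem_span_singleton_self t)
  rw [ht] at h
  exact Ideal.mem_sup_left h

/-- **(hstab) for a boundary of stable regular divisors**: for closed sets `D₁, …, D_n` through `x`, each
`I`-stable, with principal stalk ideals `I(Dᵢ)_x = (zᵢ)`, every `zᵢ` spans a `τ`-stable line of `𝔪_x/𝔪_x²`.
[folklore] -/
theorem stableLines_of_stableDivisors {n : ℕ} (D : Fin n → Closeds X)
    (hD : ∀ (g : I) (i : Fin n), (σ (g : G)).hom.base ⁻¹' (D i : Set X) = D i)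
    (z : Fin n → X.presheaf.stalk x) (hz : ∀ i, stalkIdeal (vanishingIdeal (D i)) x = Ideal.span {z i}) :
    ∀ (g : I) (i : Fin n), τ g (z i) ∈ Ideal.span {z i} ⊔ maximalIdeal (X.presheaf.stalk x) ^ 2 :=
  fun g i => apply_mem_span_of_stalkIdeal_eq_span σ x a τ hkey hτ (D i) (fun g => hD g i) (hz i) g

end StableSet

/-! ## Stability of a translate from disjointness of translates -/

section Strict

variable {X : Scheme.{0}} {G : Type} [Group G] (σ : G →* Aut X)

/-- **Disjoint translates are individually stable under point-fixing elements**: let `D ⊆ X` be closed and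
suppose its `G`-translates are pairwise disjoint or equal (`σ g '' D = D` or `σ g '' D ∩ D = ∅`). Then every
`g ∈ G` fixing a point of `D` satisfies `(σ g)⁻¹ D = D` — the exceptional divisor over one translate of an orbit
centre with disjoint translates is `I_x`-stable at each of its points (`G`-strictness of such boundaries).
[folklore] -/
theorem preimage_eq_of_translates_disjoint (D : Set X)
    (hdisj : ∀ g : G, (σ g).hom.base '' D = D ∨ Disjoint ((σ g).hom.base '' D) D)
    {x : X} (hx : x ∈ D) (g : G) (hgx : (σ g).hom.base x = x) :
    (σ g).hom.base ⁻¹' D = D := by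
  -- `σ g '' D` meets `D` at `x = σ g x`, so `σ g '' D = D`
  have himg : (σ g).hom.base '' D = D := by
    rcases hdisj g with h | h
    · exact h
    · exact absurd (Set.disjoint_iff.mp h ⟨⟨x, hx, hgx⟩, hx⟩) (Set.notMem_empty _)
  -- `σ g` is a bijection on points, so the preimage is `D` as well
  have hinj : Function.Injective (σ g).hom.base := (σ g).hom.homeomorph.injective
  ext y
  constructor
  · intro hy
    have hy' : (σ g).hom.base y ∈ (σ g).hom.base '' D := by rw [himg]; exact hy
    obtain ⟨y', hy', he⟩ := hy'
    rwa [← hinj he]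
  · intro hy
    change (σ g).hom.base y ∈ D
    rw [← himg]
    exact ⟨y, hy, rfl⟩

/-- The same for every element of the inertia group of a point of `D` (inertia elements fix the point).
[folklore] -/
theorem preimage_eq_of_mem_inertiaSubgroup (D : Set X)
    (hdisj : ∀ g : G, (σ g).hom.base '' D = D ∨ Disjoint ((σ g).hom.base '' D) D)
    {x : X} (hx : x ∈ D) (g : G) (hg : g ∈ inertiaSubgroup σ x) :
    (σ g).hom.base ⁻¹' D = D :=
  preimage_eq_of_translates_disjoint σ D hdisj hx g (apply_eq_of_mem_inertiaSubgroup σ hg)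

end Strict

end Summit.ResolutionOfSingularities.ResolutionOfSingularities.Theorems.WildQuotientResolution.StandardForm

end
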